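import Summits.AtomisticToContinuum.FouriersLaw.Theorems.BondHeatUncertaintyBoundedResponseBathHeatOwedHeatPriceB
import HarnessLib

/-!
# BondHeatUncertainty / BoundedResponse — «OwedHeatPrice»: the DIFFUSIVE PRICE of every late-window supplier of 11071 beneath (S)
(decomp-a2c lens-1 «grading / quantitative ladder», g116, NODE 116; imports only the tree: NODE 115 `…BathHeatOwedHeat` (+ `HarnessLib`))

TARGET `BoundedResponse` = stmt-11071 (⟺ `OhmicFloor`: `E_N ≤ C₁/N`).  RESIDUAL OF RECORD beneath (S) `SubdiffusiveBondHeat`: `LateTailFloor a 1 1`,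
supplied (NODE 115) by the SIGNED piece (OH_a) `LateOwedHeatSign a` (no rate needed) or by the GRADED pieces (OB_{a,g≤1}) `LateOvershootBudget`,
(T2_{a,e}) `LateOwedHeatSquareBudget` ((T2_{a,e}) ⟹ (OB_{a,1+e/2}), so only `e = 0` reaches the Ohmic grade).  Owed heat `𝒯_N(v) = ∫_v^∞ K_N`, in
response units `R_N(v) := (γ/T²)𝒯_N(v) = (1 − E_N) − θ_N(v)` (`owedHeat_eq_stepResponse_gap`).

THE LENS QUESTION (row 1570 (B): «(T2_{a,0}) ATTACKABLE-M; census OWED-115 decides (OB₁)/(T2₀)»): what does each SIGN-FREE supplier COST in decay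
of `R_N`, and at which grade exactly do the theorems stop?  THE CALIBRATION: the DIFFUSIVE RETURN LAW of the contact — on the pre-Thouless late window
`aN ≤ v ≤ c₀N²` the finite chain returns heat like the half-infinite one, `R_N(v) ≍ A·v^{−1/2}` with `A` FREE OF `N` (energy diffusion: return density
`∝ v^{−3/2}`, tail `∝ v^{−1/2}`); typed two-sidedly as the CEILING `(DC_{a,1/2})` (`∀ c`) and the FLOOR `(DF_{a,1/2})` (`∃ c₀`: post-Thouless the decay
is exponential and no power floor survives).  DESK EVIDENCE (OWED-115 table, NODE-g115 §5, P4 = (1,8,1,1,4), `a = 1/4`): `R_N(N/4) = 0.129, 0.125,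
0.0945, 0.0641` at `N = 16, 32, 64, 128` ⇒ `A = R·√v = 0.26, 0.35, 0.38, 0.36` — `N`-FREE from `N = 32` on, `A ≈ 0.37`.

## The price table (★ = this node's theorems; «diffusive value» = the value under (DC½) ∧ (DF½); every verdict is a THEOREM modulo (DC½)/(DF½))

* (OH_a) sign of `𝒯_N` on `[aN, ∞)` — NO RATE NEEDED (NODE 115 door) · diffusive value: `+A v^{−1/2} > 0` pre-Thouless · SIGNED supplier, TRUE-leaning.
* ★ (T1_{a,g}) `γ²∫_{aN}^{cN²}|𝒯_N| ≤ C·N^g` — door needs `g ≤ 1` (`(T1) ⟹ (OB)`, `𝒯⁻ ≤ |𝒯|`) · diffusive value `2γT²A√c·N` · `(DC_{a,α}) ⟹ (T1_{a,2−2α})`: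
  the Ohmic grade is reached EXACTLY at `α = 1/2`; `(DF½) ⟹ ¬(T1_{a,g})` for every `g < 1` · verdict TRUE-CRITICAL (zero exponent room).
* ★ (T2_{a,0}) NODE 115's window square budget — door at grade 1 · diffusive value `γ²T⁴A²·log(c₀N/a) → ∞` · `(DF_{a,α≤1/2}) ⟹ ¬(T2_{a,0})` ·
  verdict DIFFUSIVE-FALSE BY A LOGARITHM.  ERRATUM to NODE 115's docstring heuristic («`(vN)^{−1/2}` … ROOM `≍ N/log N`») and to the tag of record
  «ATTACKABLE-M» (row 1570): the kernel-level curve is `N`-free `≍ v^{−1/2}`, not `(vN)^{−1/2}`; the window `L²`-mass of a scale-invariant density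
  `𝒯² ≍ v^{−1}` is a LOGARITHM of the window's aspect ratio `c₀N/a`.  A census at `N ≤ 128` would see `0.137·log(cN/a)·γ²T⁴` creep by `≈ 24` (P4 units)
  per doubling of `N` and could misread it as bounded.  `(T2_{a,e})` for `e > 0` is diffusive-true but its door `(OB_{a,1+e/2})` sits above the Ohmic grade.
* ★ (T2⁸_a) OCTAVE square budget `γ⁴∫_v^{2v}𝒯_N² ≤ C` for `[v,2v] ⊂ [aN, cN²]` — door at grade 1: `(T2⁸_a) ⟹ (T1_{a,1}) ⟹ (OB_{a,1})` (blockwise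
  Cauchy–Schwarz + dyadic geometric sum, `dyadic_variation_le`) · diffusive value `γ²T⁴A²·log 2`, `N`-FLAT · `(DC½) ⟹ (T2⁸)`, `(T2_{a,0}) ⟹ (T2⁸)` ·
  verdict TRUE-CRITICAL — THE sign-free `L²` supplier that survives the diffusive law (scale-invariant = Besov-`B^{1/2}_{2,∞}` form of the critic's
  low-frequency Hölder-½ reading of `K̂_N`, where the plain window/`H^{−1}` form is killed by the log).
* ★ (DC_{a,α}) two-sided ceiling — door needs `α ≥ 1/2` (`(S) ∧ (DC_{a,α∈[1/2,1)}) ⟹ 11071`) · `(DF½) ⟹ ¬(DC_{a,α'})` for `α' > 1/2` · TRUE-CRITICAL at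
  `α = 1/2`; recorded as the PRICE LINE, not as the line of attack (a two-sided rate is more than the door needs: (T2⁸)/(T1₁) are its sign-free shadows,
  (OH) its signed one).
* ★ (LC_{a,η}) light-cone incompleteness `1 − θ_N(aN) ≤ A/N^η` with the one-lag floor (LRF_{a,η}) — door reaches `ExponentFloor η` ONLY
  (`exponentFloor_of_lightCone`), not 11071 · diffusive value of `√N(1 − θ_N(aN))`: `√N·E_N + A/√a`, flat (desk: `0.69, 0.84, 0.84, 0.79` at
  `N = 16…128`) · `(DF_{a,α}) ⟹ ¬(LC_{a,η})` for `η > α`; `11071 ∧ (DC_{a,α≤1}) ⟹ (LC_{a,α})` · verdict: `N`-FREE (light-cone / half-infinite-chain)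
  information stops at `HalfOhmicFloor` (`E_N ≤ C/√N`) EXACTLY — the typed and priced form of the g55 remark «the light-cone split lands at `N^{−1/2}`
  and no more» (`…EscapeGrading.HalfOhmicFloor`).

SIGN-OR-RATE LAW (the table in one line): beneath (S), a supplier of the residual is either SIGNED (then rate-free: (OH), (OHK), (HR) of NODE 115) or
SIGN-FREE, and then it holds EXACTLY at the diffusive return exponent (`v^{−1/2}` tail / `v^{−3/2}` kernel — cf. the tree's pointwise price «`p = 0`
already gives grade 1 at `α = 3/2`», `bathTailFloor_of_bathKernelFloor`) with ZERO exponent to spare; integrated over the whole late window at the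
critical exponent an `L²` budget picks up `log N` and fails — only SCALE-LOCALISED (octave) `L²` budgets are both true and sufficient.

## Doors (all beneath (S) via NODE 115's `boundedResponse_of_subdiffusiveBondHeat_lateOvershootBudget`)
`(S) ∧ (T1_{a,g≤1}) ⟹ 11071` · `(S) ∧ (T2⁸_a) ⟹ 11071` · `(S) ∧ (DC_{a,α}) ⟹ 11071` (`1/2 ≤ α < 1`) · `(LC_{a,η}) ∧ (LRF_{a,η}) ⟹ ExponentFloor η`
(`η = 1/2`: `HalfOhmicFloor`) · summary `diffusivePrice_ladder` = the whole table under (DC½) ∧ (DF½).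

## Census OWED-116 (pre-registration for the endorsed kernel-level instrument OWED-115; response units, P4, `a ∈ {1/4, 1}`, `c = 1/4`; zero kit here)
(i) √N-COLLAPSE `√N·R_N(aN) → A/√a` (`a = 1/4`: `0.52, 0.71, 0.76, 0.73` at `N = 16…128`, predicted limit `0.74`);  (ii) OCTAVE number
`max_{v dyadic ∈ [aN, cN²/2]} Σ_{[v,2v]} R_N²Δu → A²log 2 ≈ 0.095` (`× γ²T⁴ = 256`: `≈ 24`), `N`-FLAT ⇒ (T2⁸) numerically;  (iii) WINDOW number
`Σ_{[aN,cN²]} R_N²Δv ≈ 0.137·log(cN/a)`, GROWING by `≈ 0.095` per doubling ⇒ (T2₀) refuted numerically iff the growth is resolved (needs the ×16 run of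
OWED-115 at `N = 256`);  (iv) VARIATION number `N⁻¹Σ_{[aN,cN²]}|R_N|Δv → 2A√c ≈ 0.37`, flat ⇒ (T1₁);  (v) (OB₁) number `N⁻¹Σ R_N⁻Δv → 0`;
(vi) LIGHT-CONE number `√N(1 − θ_N(aN))` flat `≈ 0.8` and `N(1 − θ_N(aN))` GROWING `≍ √N` ⇒ (LC½) yes, (LC₁) no.  Decision rule: (i) flat within
errors over `N = 32…256` CONFIRMS the calibration and with it every verdict of the table; (i) decaying like `N^{−δ}` would move the critical exponents
by `δ` (then (T2₀) needs re-pricing, `not_…` theorems stay valid but their hypothesis (DF½) fails).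

## Tags
(DC_{a,α}), (DF_{a,α}): UNDECIDED · PRICING HYPOTHESES (calibration; `N`-free-in-spirit; INSTRUMENTABLE (i)) · IDEA-NEEDED (decay rate of a boundary
autocorrelation of the half-infinite anharmonic chain + pre-Thouless locality) — NOT proposed as proof targets.  (T1_{a,1}), (T2⁸_a): UNDECIDED ·
WEAKER-than-(DC½) · SIGN-FREE · exponent-CRITICAL · INSTRUMENTABLE (ii)/(iv) · IDEA-NEEDED — the proposed sign-free targets.  (T2_{a,0}): DIFFUSIVE-FALSE
(demoted from ATTACKABLE-M).  (LC_{a,1/2}) ∧ (LRF_{a,1/2}): UNDECIDED · `N`-FREE-in-spirit · reach = `HalfOhmicFloor` exactly (a RUNG, not the target).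
COSTUME: none (no piece mentions `E_N`; 11071 enters only through (S)).  BARRIER: the Ohmic grade itself — every sign-free piece is critical, so any
proof must produce the diffusive exponent `1/2` on the nose (no slack to trade for generality).

## Why novel / why strictly weaker (audit sentences)
NOVEL: the lineage priced the POINTWISE kernel floor (g107/109: `BathKernelFloor 0 (3/2)` ⟹ grade 1) and built the late-window suppliers (g115); nobody
priced the INTEGRATED / two-sided / sign-free suppliers against the diffusive law, and the price is decisive: it REFUTES (modulo (DF½)) the supplier the
critic had just tagged attackable, REPLACES it by the octave budget with a complete door, and FIXES the exact stop grade (`η = 1/2`) of all `N`-free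
(light-cone) information, each as a 0-sorry theorem.  STRICTLY WEAKER than 11071 ∧ (S): (T1₁), (T2⁸), (DC½) constrain only the late window of the
scalar curve `θ_N` and say nothing about `E_N = 1 − θ_N(∞)` (11071) — they feed 11071 only through (S); conversely 11071 constrains `θ_N(∞)` only and
implies none of them; (LC½) ∧ (LRF½) reach `HalfOhmicFloor`, strictly below 11071 on the exponent ladder (`exponentFloor_anti`).
-/

noncomputable section

open MeasureTheory ProbabilityTheory Filter Topology Set Function
open scoped NNReal ENNReal
open Literature.MathematicalPhysics.KineticTheory.HeatConduction
open Literature.MathematicalPhysics.KineticTheory OscillatorChain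
open Literature.Probability.Process
open Summit.AtomisticToContinuum.FouriersLaw.Theorems.SubdiffusiveBondHeat
open Summit.AtomisticToContinuum.FouriersLaw.Theorems.SubdiffusiveBondHeat.EscapeGrading
open Summit.AtomisticToContinuum.FouriersLaw.Theorems.BoundedResponse.TransientBand

namespace Summit.AtomisticToContinuum.FouriersLaw.Theorems.BoundedResponse.HeatSpreading

open Summit.AtomisticToContinuum.FouriersLaw.Theses.BondHeatUncertainty (BoundedResponse SubdiffusiveBondHeat)

section Chain

variable {ω₂ lam β γ : ℝ} {T : ℝ}

/-! ## §5 THE LIGHT-CONE DOOR and its exact ceiling `η = 1/2` -/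

/-- ★★ **DOOR: (LC_{a,η}) ∧ (LRF_{a,η}) ⟹ `ExponentFloor η`** (`a ≥ 0`): `E_N = (1 − θ_N(aN)) − (γ/T²)𝒯_N(aN) ≤ (A + A')/N^η`
(`owedHeat_eq_stepResponse_gap`).  At `η = 1` both pieces are diffusive-FALSE at the light-cone lag; at `η = 1/2` both are `N`-free in spirit:
the door's reach is `HalfOhmicFloor`, exactly. [this cell] -/
theorem exponentFloor_of_lightCone {a η : ℝ} (ha : 0 ≤ a) (h1 : LightConeIncompleteness a η) (h2 : LightConeReturnFloor a η) :
    ExponentFloor η := by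
  intro ω₂ lam β γ hω hl hβ hγ T hT
  obtain ⟨A, N₀, hA⟩ := h1 ω₂ lam β γ hω hl hβ hγ T hT
  obtain ⟨A', N₀', hA'⟩ := h2 ω₂ lam β γ hω hl hβ hγ T hT
  refine ⟨A + A', max N₀ N₀', fun N hN => ?_⟩
  have hNN₀ : N₀ ≤ N := le_trans (le_max_left _ _) hN
  have hNN₀' : N₀' ≤ N := le_trans (le_max_right _ _) hN
  have hid := owedHeat_eq_stepResponse_gap hω hl hβ hγ hT N (by positivity : (0:ℝ) ≤ a * N)
  have e : escapeDeficit ω₂ lam β γ T N =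
      (1 - stepResponse ω₂ lam β γ T N (a * N)) - γ / T ^ 2 * owedHeat ω₂ lam β γ T N (a * N) := by linarith
  rw [e, add_div]
  linarith [hA N hNN₀, hA' N hNN₀']

/-- ★ **(LC_{a,1/2}) ∧ (LRF_{a,1/2}) ⟹ `HalfOhmicFloor`** (`E_N ≤ C/√N`). [this cell] -/
theorem halfOhmicFloor_of_lightCone {a : ℝ} (ha : 0 ≤ a) (h1 : LightConeIncompleteness a (1 / 2))
    (h2 : LightConeReturnFloor a (1 / 2)) : HalfOhmicFloor :=
  exponentFloor_of_lightCone ha h1 h2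

/-- ★★ **`(DF_{a,α}) ⟹ ¬(LC_{a,η})` for `η > α`** (`a > 0`): `1 − θ_N(aN) = E_N + (γ/T²)𝒯_N(aN) ≥ (γ/T²)a₀(aN)^{−α}` (`E_N ≥ 0`, tree) — light-cone
data cannot reach beyond the diffusive exponent: with `α = 1/2`, every `η > 1/2` is refuted, so the light-cone door stops at `HalfOhmicFloor`
EXACTLY. [this cell] -/
theorem not_lightConeIncompleteness_of_lateReturnFloor {a α η : ℝ} (ha : 0 < a) (hαη : α < η) (h : LateReturnFloor a α) :
    ¬ LightConeIncompleteness a η := by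
  intro hLC
  obtain ⟨c₀, hc₀, a₀, ha₀, N₀, hF⟩ := h 1 1 1 1 one_pos one_pos one_pos one_pos 1 one_pos
  obtain ⟨A, N₂, hA⟩ := hLC 1 1 1 1 one_pos one_pos one_pos one_pos 1 one_pos
  have hκ : 0 < a₀ * a ^ (-α) := by positivity
  obtain ⟨N₃, hN₃⟩ := exists_nat_rpow_dominate (show -η < -α by linarith) hκ A
  obtain ⟨N₁, hN₁⟩ := eventually_lateWindow (a := a) (q := 1) hc₀ (max (max N₀ N₂) (max N₃ 2))
  obtain ⟨hNmax, hN1, hw⟩ := hN₁ N₁ le_rfl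
  set N := N₁ with hNdef
  have hNN₀ : N₀ ≤ N := le_trans (le_max_left _ _) (le_trans (le_max_left _ _) hNmax)
  have hNN₂ : N₂ ≤ N := le_trans (le_max_right _ _) (le_trans (le_max_left _ _) hNmax)
  have hNN₃ : N₃ ≤ N := le_trans (le_max_left _ _) (le_trans (le_max_right _ _) hNmax)
  have hN2 : 2 ≤ N := le_trans (le_max_right _ _) (le_trans (le_max_right _ _) hNmax)
  have hN0 : (0:ℝ) < N := by exact_mod_cast hN1
  have haN : (0:ℝ) < a * N := by positivity
  have hle : a * (N : ℝ) ≤ c₀ * (N : ℝ) ^ 2 := by linarith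
  have h1 : a₀ * (a * (N:ℝ)) ^ (-α) ≤ owedHeat 1 1 1 1 1 N (a * N) := hF N hNN₀ _ le_rfl hle
  have hid := owedHeat_eq_stepResponse_gap one_pos one_pos one_pos one_pos one_pos N haN.le
  have hE : 0 ≤ escapeDeficit 1 1 1 1 1 N := escapeDeficit_nonneg' one_pos one_pos one_pos one_pos one_pos hN2
  have h2 : 1 - stepResponse 1 1 1 1 1 N (a * N) ≤ A / (N:ℝ) ^ η := hA N hNN₂
  have e1 : (a * (N:ℝ)) ^ (-α) = a ^ (-α) * (N:ℝ) ^ (-α) := Real.mul_rpow ha.le hN0.le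
  have e2 : A / (N:ℝ) ^ η = A * (N:ℝ) ^ (-η) := by rw [Real.rpow_neg hN0.le, div_eq_mul_inv]
  have hdom := hN₃ N hNN₃
  rw [e1] at h1
  rw [e2] at h2
  have h3 : (1:ℝ) / 1 ^ 2 * owedHeat 1 1 1 1 1 N (a * N) = owedHeat 1 1 1 1 1 N (a * N) := by norm_num
  rw [h3] at hid
  nlinarith [h1, h2, hE, hid, hdom]

/-- **`(DC_{a,α}) ⟹ (LRF_{a,α})`** (`a > 0`): the two-sided ceiling at the single lag `aN` gives the one-lag graded floor (`(aN)^{−α} = a^{−α}N^{−α}`). [this cell] -/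
theorem lightConeReturnFloor_of_lateReturnCeiling {a α : ℝ} (ha : 0 < a) (h : LateReturnCeiling a α) : LightConeReturnFloor a α := by
  intro ω₂ lam β γ hω hl hβ hγ T hT
  obtain ⟨A, N₀, hA⟩ := h ω₂ lam β γ hω hl hβ hγ T hT 1 one_pos
  obtain ⟨N₁, hN₁⟩ := eventually_lateWindow (a := a) (q := 1) one_pos N₀
  refine ⟨γ / T ^ 2 * (max A 0 * a ^ (-α)), N₁, fun N hN => ?_⟩
  obtain ⟨hNN₀, hN1, hw⟩ := hN₁ N hN
  have hN0 : (0:ℝ) < N := by exact_mod_cast hN1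
  have haN : 0 < a * (N:ℝ) := by positivity
  have h1 : |owedHeat ω₂ lam β γ T N (a * N)| ≤ max A 0 * (a * (N:ℝ)) ^ (-α) :=
    (hA N hNN₀ _ le_rfl (by linarith)).trans (mul_le_mul_of_nonneg_right (le_max_left _ _) (Real.rpow_nonneg haN.le _))
  rw [Real.mul_rpow ha.le hN0.le] at h1
  have hγT : 0 < γ / T ^ 2 := by positivity
  have h2 : γ / T ^ 2 * (-(max A 0 * (a ^ (-α) * (N:ℝ) ^ (-α)))) ≤ γ / T ^ 2 * owedHeat ω₂ lam β γ T N (a * N) :=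
    mul_le_mul_of_nonneg_left (by linarith [neg_abs_le (owedHeat ω₂ lam β γ T N (a * N))]) hγT.le
  have e2 : (N:ℝ) ^ (-α) = 1 / (N:ℝ) ^ α := by rw [Real.rpow_neg hN0.le, one_div]
  rw [e2] at h2
  have e3 : γ / T ^ 2 * (-(max A 0 * (a ^ (-α) * (1 / (N:ℝ) ^ α)))) = -(γ / T ^ 2 * (max A 0 * a ^ (-α)) / (N:ℝ) ^ α) := by ring
  rw [e3] at h2
  exact h2

/-- **11071 ∧ (DC_{a,α}) ⟹ (LC_{a,α})` for `α ≤ 1`** (`a > 0`): `1 − θ_N(aN) = E_N + (γ/T²)𝒯_N(aN) ≤ C/N^α + (γ/T²)A a^{−α}N^{−α}` — under the target and the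
diffusive ceiling the light-cone piece HOLDS at `η = 1/2`: together with `not_lightConeIncompleteness_of_lateReturnFloor`, its exact grade is `η = 1/2`
(consistency of the price table; not a door). [this cell] -/
theorem lightConeIncompleteness_of_boundedResponse_lateReturnCeiling {a α : ℝ} (ha : 0 < a) (hα : α ≤ 1)
    (hB : BoundedResponse) (h : LateReturnCeiling a α) : LightConeIncompleteness a α := by
  intro ω₂ lam β γ hω hl hβ hγ T hT
  obtain ⟨C, N₀, hC⟩ := exponentFloor_of_boundedResponse hα hB ω₂ lam β γ hω hl hβ hγ T hT
  obtain ⟨A, N₀', hA⟩ := h ω₂ lam β γ hω hl hβ hγ T hT 1 one_pos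
  obtain ⟨N₁, hN₁⟩ := eventually_lateWindow (a := a) (q := 1) one_pos (max N₀ N₀')
  refine ⟨C + γ / T ^ 2 * (max A 0 * a ^ (-α)), N₁, fun N hN => ?_⟩
  obtain ⟨hNmax, hN1, hw⟩ := hN₁ N hN
  have hNN₀ : N₀ ≤ N := le_trans (le_max_left _ _) hNmax
  have hNN₀' : N₀' ≤ N := le_trans (le_max_right _ _) hNmax
  have hN0 : (0:ℝ) < N := by exact_mod_cast hN1
  have haN : 0 < a * (N:ℝ) := by positivity
  have h1 : |owedHeat ω₂ lam β γ T N (a * N)| ≤ max A 0 * (a * (N:ℝ)) ^ (-α) :=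
    (hA N hNN₀' _ le_rfl (by linarith)).trans (mul_le_mul_of_nonneg_right (le_max_left _ _) (Real.rpow_nonneg haN.le _))
  rw [Real.mul_rpow ha.le hN0.le] at h1
  have hid := owedHeat_eq_stepResponse_gap hω hl hβ hγ hT N haN.le
  have hE := hC N hNN₀
  have hγT : 0 < γ / T ^ 2 := by positivity
  have h2 : γ / T ^ 2 * owedHeat ω₂ lam β γ T N (a * N) ≤ γ / T ^ 2 * (max A 0 * (a ^ (-α) * (N:ℝ) ^ (-α))) :=
    mul_le_mul_of_nonneg_left ((le_abs_self _).trans h1) hγT.le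
  have e2 : (N:ℝ) ^ (-α) = 1 / (N:ℝ) ^ α := by rw [Real.rpow_neg hN0.le, one_div]
  rw [e2] at h2
  have e3 : γ / T ^ 2 * (max A 0 * (a ^ (-α) * (1 / (N:ℝ) ^ α))) = γ / T ^ 2 * (max A 0 * a ^ (-α)) / (N:ℝ) ^ α := by ring
  rw [e3] at h2
  rw [add_div]
  linarith

/-! ## §6 THE DIFFUSIVE PRICE TABLE in one statement -/

/-- ★★★ **The diffusive truth table of the late-window suppliers.**  Under the two-sided DIFFUSIVE RETURN LAW on an initial Thouless fraction
(`(DC_{a,1/2}) ∧ (DF_{a,1/2})`, `a > 0`):  TRUE side — the octave square budget `(T2⁸_a)`, the Ohmic-grade variation budget `(T1_{a,1})`, the one-lag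
return floor `(LRF_{a,1/2})`;  FALSE side — NODE 115's window square budget `(T2_{a,0})`, every sub-Ohmic variation grade `(T1_{a,g<1})`, every light-cone
grade `(LC_{a,η>1/2})`, every faster ceiling `(DC_{a,α'>1/2})`.  Every TRUE entry is exponent-CRITICAL (its next grade is on the FALSE side).  This is the
«price table» the lens was asked for; its census form is the module docstring's OWED-116 pre-registration. [this cell] -/
theorem diffusivePrice_ladder {a : ℝ} (ha : 0 < a) (hC : LateReturnCeiling a (1 / 2)) (hF : LateReturnFloor a (1 / 2)) :
    (OctaveSquareBudget a ∧ LateVariationBudget a 1 ∧ LightConeReturnFloor a (1 / 2)) ∧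
    (¬ LateOwedHeatSquareBudget a 0 ∧ (∀ g : ℝ, g < 1 → ¬ LateVariationBudget a g) ∧
      (∀ η : ℝ, 1 / 2 < η → ¬ LightConeIncompleteness a η) ∧ (∀ α' : ℝ, 1 / 2 < α' → ¬ LateReturnCeiling a α')) := by
  refine ⟨⟨octaveSquareBudget_of_lateReturnCeiling_half ha hC, ?_, lightConeReturnFloor_of_lateReturnCeiling ha hC⟩,
    ⟨not_lateOwedHeatSquareBudget_zero_of_lateReturnFloor ha le_rfl hF,
      fun g hg => not_lateVariationBudget_of_lateReturnFloor ha (by norm_num) (by linarith) hF,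
      fun η hη => not_lightConeIncompleteness_of_lateReturnFloor ha hη hF,
      fun α' hα' => not_lateReturnCeiling_of_lateReturnFloor hα' hF⟩⟩
  have h := lateVariationBudget_of_lateReturnCeiling ha (by norm_num) hC
  norm_num at h
  exact h

end Chain

end Summit.AtomisticToContinuum.FouriersLaw.Theorems.BoundedResponse.HeatSpreading

end
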